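import Summits.QuantumFields.BalabanUV.Beta.SecondOrderContactForm
import Summits.QuantumFields.BalabanUV.Beta.GAN24.CovariantFamilyCellPairing

/-!
# `BalabanUV.Beta.GAN24.ZeroModeReflectionParityWords` — binder row G-an2-4 ∕ (CONV-C), W-slot, row (C) at levels ≥ 1, THE QUADRATIC HALF OF THE PARITY DEFECT:
# **THE `conjW₂` DELTA WORDS OF A REFLECTION CONTACT ADD ff CHARGE ONLY ON THE ALL-EQUAL PATTERN** (given the sandwich kernel's Ward zeros)
# (road-P2 chair of row G-an2-4, unit `b2b-balaban-gan24-p2` gen 47, crux team (2); READING R-2 (2)(c), WANTED W-an2-1∕3 [GAN24P2-G47-W3])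

NOT IN PRINT; OUR BOOKKEEPING ([folklore] the ff double sum of an2's `ChartConjugation.conjW₂` on diagonal generators with single-site single-component field legs;
0 `def`, 0 cited facts, 0 `def … : Prop`, 0 sorry).  HONEST FRAMING (cell contract, verbatim): «discharging `BetaPertH` makes Bałaban's UV stability UNCONDITIONAL —
a real constructive-QFT result; it is NOT the continuum limit and NOT the Clay problem.»  HONEST DEPENDENCY (verbatim): «continuum YM on T⁴ ⇐ BetaPertH ∧ nine spine
estimates (0/9 proved); BetaPertH ⇐ (D1) ∧ (D4) ∧ CAP+tail; G-an2-4 gates asym, D1 and NE2/3/4.»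

WHAT (generic `d`; `X = diagK g`, `X′ = diagK g′` with FIELD legs the deltas `[x = u ∧ β = β₀]·c`, `[x = u′ ∧ β = β₀′]·c′` — an2's `ctGen` at the two jet bonds —, `X₂ = diagK h`
with a field leg of FINITE site support; `𝕄` with summable rows∕columns and ZERO ff constant modes on both sides — `bhKStepAt`'s `E2` block):
* (entrywise form = an2's `SecondOrderContactForm.conjW₂_diag_apply`, reused BY NAME: on the ff block the `(XX′+X′X)𝕄` group is `[x = u = u′][κ₁ = β₀ = β₀′]·2cc′·𝕄 x z`,
  the `X𝕄X′+X′𝕄X` group is `[x = u][z = u′][κ₁ = β₀][κ₂ = β₀′]·cc′·𝕄 u u′ + (mirror)`, the `[𝕄, X₂]` group is `𝕄 x z·(h z − h x)`.)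
* **`tsum_tsum_conjW₁_diagK_eq`**: `Σ'_x Σ'_z conjW₁ V V′ X X′ x z (inl κ₁)(inl κ₂) = c·([κ₂ = β₀]·Σ'_x V′ x u − [κ₁ = β₀]·Σ'_z V′ u z) + c′·([κ₂ = β₀′]·Σ'_x V x u′ − [κ₁ = β₀′]·Σ'_z V u′ z)`
  — one-leg-pinned row∕column sums of the two CUBIC kernels (an2's `conjW₁_diag_apply` reused); after the bond-slot cell sums these are cubic cell charges (re-centred by
  leaf-04's `CovariantFamilyCellPairing.sum_box_tsum_mul_periodic`), zero by `ZeroModeReflectionParity.cubicCharge_eq_zero_of_refl_conjV`.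
* `sum_box_tsum_tsum_recentre`: the RE-CENTRING `Σ_{r∈box} Σ'_u Σ'_x S κ′ u x (toSite r) = Σ_{r∈box} Σ'_x Σ'_z S κ′ (toSite r) x z` (leaf-04's `sum_box_tsum_mul_periodic` at `A := 1`
  + Fubini on the two kernel legs) — turns the one-leg-pinned sums of the previous bullet into the cubic cell charges of `ZeroModeReflectionParity` §4–§5.
* **`tsum_tsum_conjW₂_diagK_eq`**: `Σ'_x Σ'_z conjW₂ 𝕄 X X′ X₂ x z (inl κ₁)(inl κ₂) = −([κ₁ = β₀ ∧ κ₂ = β₀′]·cc′·𝕄 u u′ (inl β₀)(inl β₀′) + [κ₁ = β₀′ ∧ κ₂ = β₀]·c′c·𝕄 u′ u (inl β₀′)(inl β₀))`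
  — the square group and the `[𝕄, X₂]` commutator are pinned row∕column constant modes of `𝕄` (zero); ONLY the sandwich survives, and only on the leg pattern `{κ₁, κ₂} = {β₀, β₀′}`;
  **`tsum_tsum_conjW₂_diagK_eq_zero_of_ne`**: `= 0` whenever `(κ₁, κ₂) ∉ {(β₀, β₀′), (β₀′, β₀)}` — for an2's `ctGen` (`β₀ = κ = α`, `β₀′ = κ′ = α`) this is EVERY pattern but the
  all-equal one `(α,α;α,α)`, in particular every odd-multiplicity pattern.
READING (zero weight): with `ZeroModeReflectionParity` §3 (`R2`), §4–§5 (`conjW₁` ↦ cubic charges ↦ 0) and this file (`conjW₂`), the parity defect `J_j^α` of the comb tower adds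
no leg-symmetrised charge on odd-multiplicity patterns GIVEN an2's two reflection laws at the literal (WANTED W-an2-1∕2) and the re-centring of the cubic cell charge — the
odd-pattern half of (C)_{≥1} then needs no exchange∕contact valuation.  Discharges NOTHING of (C)_{≥1} by itself; NEVER «G-an2-4 closed» as (CONV-C); NOT D1, NOT `BetaPertH`,
NOT continuum, NOT Clay.  2026-08-23; no existing file touched.
-/

noncomputable section

open Finset
open scoped BigOperators
open Literature.MathematicalPhysics.QuantumFieldTheory
open Literature.MathematicalPhysics.QuantumFieldTheory.Balaban1983to89
open Literature.MathematicalPhysics.QuantumFieldTheory.Balaban1983to89.Beta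
open ExpKernelCalculus (MKer comp shiftK)
open AffineAveraging (box toSite)
open Summit.QuantumFields.BalabanUV.Beta.GAN24.CovariantFamilyCellPairing (sum_box_tsum_mul_periodic)
open OneStepResolventKernel (Fib)
open Summit.QuantumFields.BalabanUV.Beta.ChartConjugation (conjV conjW₁ conjW₂)
open Summit.QuantumFields.BalabanUV.Beta.BorderedHessian (diagK)
open Summit.QuantumFields.BalabanUV.Beta.SecondOrderContactForm (conjW₁_diag_apply conjW₂_diag_apply)
open Summit.QuantumFields.BalabanUV.Beta.AxialDressingRooted (tsum_point tsum_point')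

namespace Summit.QuantumFields.BalabanUV.Beta.GAN24.ZeroModeReflectionParityWords

variable {d : ℕ}

/-! ## The ff double sum of the quadratic contact: only the sandwich survives, and only on the leg pattern `{β₀, β₀′}` -/

/-- NOT IN PRINT; OUR BOOKKEEPING.  **THE QUADRATIC DELTA WORDS' ff CHARGE**: with single-site single-component delta field legs `g`, `g′` at `(u, β₀)`, `(u′, β₀′)`, a finitely
site-supported field leg `h`, and a sandwich kernel `𝕄` with summable rows∕columns and zero ff constant modes on both sides,
`Σ'_x Σ'_z conjW₂ 𝕄 (diagK g) (diagK g′) (diagK h) x z (inl κ₁) (inl κ₂) = −([κ₁ = β₀][κ₂ = β₀′]·c·c′·𝕄 u u′ (inl β₀) (inl β₀′) + [κ₁ = β₀′][κ₂ = β₀]·c′·c·𝕄 u′ u (inl β₀′) (inl β₀))`. -/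
theorem tsum_tsum_conjW₂_diagK_eq {𝕄 : MKer (d + 1) (Fib d)} {g g' h : (Fin (d + 1) → ℤ) → Fib d → ℝ} {u u' : Fin (d + 1) → ℤ} {β₀ β₀' : Fin (d + 1)} {c c' : ℝ}
    {s : Finset (Fin (d + 1) → ℤ)}
    (hg : ∀ (x : Fin (d + 1) → ℤ) (β : Fin (d + 1)), g x (Sum.inl β) = if x = u ∧ β = β₀ then c else 0)
    (hg' : ∀ (x : Fin (d + 1) → ℤ) (β : Fin (d + 1)), g' x (Sum.inl β) = if x = u' ∧ β = β₀' then c' else 0)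
    (hh : ∀ x ∉ s, ∀ (β : Fin (d + 1)), h x (Sum.inl β) = 0)
    (hMrow : ∀ (x : Fin (d + 1) → ℤ) (a b : Fin (d + 1)), Summable fun z => 𝕄 x z (Sum.inl a) (Sum.inl b))
    (hMcol : ∀ (z : Fin (d + 1) → ℤ) (a b : Fin (d + 1)), Summable fun x => 𝕄 x z (Sum.inl a) (Sum.inl b))
    (hrow0 : ∀ (x : Fin (d + 1) → ℤ) (a b : Fin (d + 1)), ∑' z, 𝕄 x z (Sum.inl a) (Sum.inl b) = 0)
    (hcol0 : ∀ (z : Fin (d + 1) → ℤ) (a b : Fin (d + 1)), ∑' x, 𝕄 x z (Sum.inl a) (Sum.inl b) = 0) (κ₁ κ₂ : Fin (d + 1)) :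
    (∑' x, ∑' z, conjW₂ 𝕄 (diagK g) (diagK g') (diagK h) x z (Sum.inl κ₁) (Sum.inl κ₂))
      = -((if κ₁ = β₀ ∧ κ₂ = β₀' then c * c' * 𝕄 u u' (Sum.inl β₀) (Sum.inl β₀') else 0)
          + (if κ₁ = β₀' ∧ κ₂ = β₀ then c' * c * 𝕄 u' u (Sum.inl β₀') (Sum.inl β₀) else 0)) := by
  classical
  -- the summand, split into five pieces A − (B + C) + (D − E)
  have hsplit : ∀ x z, conjW₂ 𝕄 (diagK g) (diagK g') (diagK h) x z (Sum.inl κ₁) (Sum.inl κ₂)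
      = (2 * (g x (Sum.inl κ₁) * g' x (Sum.inl κ₁)) * 𝕄 x z (Sum.inl κ₁) (Sum.inl κ₂) - (g x (Sum.inl κ₁) * (𝕄 x z (Sum.inl κ₁) (Sum.inl κ₂) * g' z (Sum.inl κ₂)) + g' x (Sum.inl κ₁) * (𝕄 x z (Sum.inl κ₁) (Sum.inl κ₂) * g z (Sum.inl κ₂)))) + (𝕄 x z (Sum.inl κ₁) (Sum.inl κ₂) * h z (Sum.inl κ₂) - 𝕄 x z (Sum.inl κ₁) (Sum.inl κ₂) * h x (Sum.inl κ₁)) := by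
    intro x z
    rw [conjW₂_diag_apply]
    ring
  -- summabilities in `z` at fixed `x`
  have sA : ∀ x, Summable fun z => 2 * (g x (Sum.inl κ₁) * g' x (Sum.inl κ₁)) * 𝕄 x z (Sum.inl κ₁) (Sum.inl κ₂) := fun x => (hMrow x κ₁ κ₂).mul_left _
  have sB : ∀ x, Summable fun z => g x (Sum.inl κ₁) * (𝕄 x z (Sum.inl κ₁) (Sum.inl κ₂) * g' z (Sum.inl κ₂)) := fun x => by
    refine Summable.mul_left _ (summable_of_ne_finset_zero (s := {u'}) fun z hz => ?_)
    rw [Finset.mem_singleton] at hz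
    rw [hg', if_neg (fun hh => hz hh.1), mul_zero]
  have sC : ∀ x, Summable fun z => g' x (Sum.inl κ₁) * (𝕄 x z (Sum.inl κ₁) (Sum.inl κ₂) * g z (Sum.inl κ₂)) := fun x => by
    refine Summable.mul_left _ (summable_of_ne_finset_zero (s := {u}) fun z hz => ?_)
    rw [Finset.mem_singleton] at hz
    rw [hg, if_neg (fun hh => hz hh.1), mul_zero]
  have sD : ∀ x, Summable fun z => 𝕄 x z (Sum.inl κ₁) (Sum.inl κ₂) * h z (Sum.inl κ₂) := fun x =>
    summable_of_ne_finset_zero (s := s) fun z hz => by rw [hh z hz, mul_zero]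
  have sE : ∀ x, Summable fun z => 𝕄 x z (Sum.inl κ₁) (Sum.inl κ₂) * h x (Sum.inl κ₁) := fun x => (hMrow x κ₁ κ₂).mul_right _
  -- inner sums
  have iA : ∀ x, ∑' z, 2 * (g x (Sum.inl κ₁) * g' x (Sum.inl κ₁)) * 𝕄 x z (Sum.inl κ₁) (Sum.inl κ₂) = 0 := fun x => by rw [tsum_mul_left, hrow0, mul_zero]
  have iE : ∀ x, ∑' z, 𝕄 x z (Sum.inl κ₁) (Sum.inl κ₂) * h x (Sum.inl κ₁) = 0 := fun x => by rw [tsum_mul_right, hrow0, zero_mul]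
  have iB : ∀ x, ∑' z, g x (Sum.inl κ₁) * (𝕄 x z (Sum.inl κ₁) (Sum.inl κ₂) * g' z (Sum.inl κ₂)) = g x (Sum.inl κ₁) * (𝕄 x u' (Sum.inl κ₁) (Sum.inl κ₂) * (if κ₂ = β₀' then c' else 0)) := fun x => by
    rw [tsum_mul_left]
    congr 1
    have e : ∀ z, 𝕄 x z (Sum.inl κ₁) (Sum.inl κ₂) * g' z (Sum.inl κ₂) = if z = u' then 𝕄 x z (Sum.inl κ₁) (Sum.inl κ₂) * (if κ₂ = β₀' then c' else 0) else 0 := by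
      intro z; rw [hg']; by_cases hz : z = u' <;> by_cases hk : κ₂ = β₀' <;> simp [hz, hk]
    simp_rw [e]
    exact tsum_point' u' fun z => 𝕄 x z (Sum.inl κ₁) (Sum.inl κ₂) * (if κ₂ = β₀' then c' else 0)
  have iC : ∀ x, ∑' z, g' x (Sum.inl κ₁) * (𝕄 x z (Sum.inl κ₁) (Sum.inl κ₂) * g z (Sum.inl κ₂)) = g' x (Sum.inl κ₁) * (𝕄 x u (Sum.inl κ₁) (Sum.inl κ₂) * (if κ₂ = β₀ then c else 0)) := fun x => by
    rw [tsum_mul_left]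
    congr 1
    have e : ∀ z, 𝕄 x z (Sum.inl κ₁) (Sum.inl κ₂) * g z (Sum.inl κ₂) = if z = u then 𝕄 x z (Sum.inl κ₁) (Sum.inl κ₂) * (if κ₂ = β₀ then c else 0) else 0 := by
      intro z; rw [hg]; by_cases hz : z = u <;> by_cases hk : κ₂ = β₀ <;> simp [hz, hk]
    simp_rw [e]
    exact tsum_point' u fun z => 𝕄 x z (Sum.inl κ₁) (Sum.inl κ₂) * (if κ₂ = β₀ then c else 0)
  have iD : ∀ x, ∑' z, 𝕄 x z (Sum.inl κ₁) (Sum.inl κ₂) * h z (Sum.inl κ₂) = ∑ z ∈ s, 𝕄 x z (Sum.inl κ₁) (Sum.inl κ₂) * h z (Sum.inl κ₂) := fun x =>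
    tsum_eq_sum fun z hz => by rw [hh z hz, mul_zero]
  have inner : ∀ x, ∑' z, conjW₂ 𝕄 (diagK g) (diagK g') (diagK h) x z (Sum.inl κ₁) (Sum.inl κ₂)
      = -(g x (Sum.inl κ₁) * (𝕄 x u' (Sum.inl κ₁) (Sum.inl κ₂) * (if κ₂ = β₀' then c' else 0))
          + g' x (Sum.inl κ₁) * (𝕄 x u (Sum.inl κ₁) (Sum.inl κ₂) * (if κ₂ = β₀ then c else 0)))
        + ∑ z ∈ s, 𝕄 x z (Sum.inl κ₁) (Sum.inl κ₂) * h z (Sum.inl κ₂) := by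
    intro x
    simp_rw [hsplit]
    rw [((sA x).sub ((sB x).add (sC x))).tsum_add ((sD x).sub (sE x)), (sA x).tsum_sub ((sB x).add (sC x)), (sB x).tsum_add (sC x),
      (sD x).tsum_sub (sE x), iA, iB, iC, iD, iE]
    ring
  simp_rw [inner]
  -- outer sums
  have oB : Summable fun x => g x (Sum.inl κ₁) * (𝕄 x u' (Sum.inl κ₁) (Sum.inl κ₂) * (if κ₂ = β₀' then c' else 0)) :=
    summable_of_ne_finset_zero (s := {u}) fun x hx => by
      rw [Finset.mem_singleton] at hx; rw [hg, if_neg (fun hh => hx hh.1), zero_mul]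
  have oC : Summable fun x => g' x (Sum.inl κ₁) * (𝕄 x u (Sum.inl κ₁) (Sum.inl κ₂) * (if κ₂ = β₀ then c else 0)) :=
    summable_of_ne_finset_zero (s := {u'}) fun x hx => by
      rw [Finset.mem_singleton] at hx; rw [hg', if_neg (fun hh => hx hh.1), zero_mul]
  have oD : Summable fun x => ∑ z ∈ s, 𝕄 x z (Sum.inl κ₁) (Sum.inl κ₂) * h z (Sum.inl κ₂) :=
    summable_sum fun z _ => (hMcol z κ₁ κ₂).mul_right _
  have vB : ∑' x, g x (Sum.inl κ₁) * (𝕄 x u' (Sum.inl κ₁) (Sum.inl κ₂) * (if κ₂ = β₀' then c' else 0))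
      = (if κ₁ = β₀ then c else 0) * (𝕄 u u' (Sum.inl κ₁) (Sum.inl κ₂) * (if κ₂ = β₀' then c' else 0)) := by
    have e : ∀ x, g x (Sum.inl κ₁) * (𝕄 x u' (Sum.inl κ₁) (Sum.inl κ₂) * (if κ₂ = β₀' then c' else 0))
        = if x = u then (if κ₁ = β₀ then c else 0) * (𝕄 x u' (Sum.inl κ₁) (Sum.inl κ₂) * (if κ₂ = β₀' then c' else 0)) else 0 := by
      intro x; rw [hg]; by_cases hx : x = u <;> by_cases hk : κ₁ = β₀ <;> simp [hx, hk]
    simp_rw [e]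
    exact tsum_point' u fun x => (if κ₁ = β₀ then c else 0) * (𝕄 x u' (Sum.inl κ₁) (Sum.inl κ₂) * (if κ₂ = β₀' then c' else 0))
  have vC : ∑' x, g' x (Sum.inl κ₁) * (𝕄 x u (Sum.inl κ₁) (Sum.inl κ₂) * (if κ₂ = β₀ then c else 0))
      = (if κ₁ = β₀' then c' else 0) * (𝕄 u' u (Sum.inl κ₁) (Sum.inl κ₂) * (if κ₂ = β₀ then c else 0)) := by
    have e : ∀ x, g' x (Sum.inl κ₁) * (𝕄 x u (Sum.inl κ₁) (Sum.inl κ₂) * (if κ₂ = β₀ then c else 0))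
        = if x = u' then (if κ₁ = β₀' then c' else 0) * (𝕄 x u (Sum.inl κ₁) (Sum.inl κ₂) * (if κ₂ = β₀ then c else 0)) else 0 := by
      intro x; rw [hg']; by_cases hx : x = u' <;> by_cases hk : κ₁ = β₀' <;> simp [hx, hk]
    simp_rw [e]
    exact tsum_point' u' fun x => (if κ₁ = β₀' then c' else 0) * (𝕄 x u (Sum.inl κ₁) (Sum.inl κ₂) * (if κ₂ = β₀ then c else 0))
  have vD : ∑' x, ∑ z ∈ s, 𝕄 x z (Sum.inl κ₁) (Sum.inl κ₂) * h z (Sum.inl κ₂) = 0 := by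
    rw [Summable.tsum_finsetSum (fun z _ => (hMcol z κ₁ κ₂).mul_right _)]
    exact Finset.sum_eq_zero fun z _ => by rw [tsum_mul_right, hcol0, zero_mul]
  rw [((oB.add oC).neg).tsum_add oD, tsum_neg, oB.tsum_add oC, vB, vC, vD, add_zero]
  have e1 : (if κ₁ = β₀ ∧ κ₂ = β₀' then c * c' * 𝕄 u u' (Sum.inl β₀) (Sum.inl β₀') else 0)
      = (if κ₁ = β₀ then c else 0) * (𝕄 u u' (Sum.inl κ₁) (Sum.inl κ₂) * (if κ₂ = β₀' then c' else 0)) := by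
    by_cases h1 : κ₁ = β₀
    · by_cases h2 : κ₂ = β₀'
      · subst h1; subst h2; simp only [and_self, if_true]; ring
      · simp [h1, h2]
    · simp [h1]
  have e2 : (if κ₁ = β₀' ∧ κ₂ = β₀ then c' * c * 𝕄 u' u (Sum.inl β₀') (Sum.inl β₀) else 0)
      = (if κ₁ = β₀' then c' else 0) * (𝕄 u' u (Sum.inl κ₁) (Sum.inl κ₂) * (if κ₂ = β₀ then c else 0)) := by
    by_cases h3 : κ₁ = β₀'
    · by_cases h4 : κ₂ = β₀
      · subst h3; subst h4; simp only [and_self, if_true]; ring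
      · simp [h3, h4]
    · simp [h3]
  rw [e1, e2]


/-! ## The first-order half `conjW₁`: its ff cell charge is a combination of CUBIC cell charges -/

/-- NOT IN PRINT; OUR BOOKKEEPING.  **THE INNER DOUBLE SUM OF `conjW₁`** on delta generators (an2's `conjW₁_diag_apply` reused): for cubic kernels `V`, `V′` and generators with
field legs the deltas `[x = u ∧ β = β₀]·c`, `[x = u′ ∧ β = β₀′]·c′`,
`Σ'_x Σ'_z conjW₁ V V′ (diagK g) (diagK g′) x z (inl κ₁)(inl κ₂) = c·([κ₂ = β₀]·Σ'_x V′ x u − [κ₁ = β₀]·Σ'_z V′ u z) + c′·([κ₂ = β₀′]·Σ'_x V x u′ − [κ₁ = β₀′]·Σ'_z V u′ z)`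
(one-leg-pinned row∕column sums of the two cubic kernels; summable rows∕columns assumed) — summed over the bond slots these are CUBIC CELL CHARGES
(`ZeroModeReflectionParity` §4–§5: zero for the comb tower's cubic tables given the (Sr-conj) law), after the re-centring of leaf-04's `CovariantFamilyCellPairing.sum_box_tsum_mul_periodic`. -/
theorem tsum_tsum_conjW₁_diagK_eq {V V' : MKer (d + 1) (Fib d)} {g g' : (Fin (d + 1) → ℤ) → Fib d → ℝ} {u u' : Fin (d + 1) → ℤ} {β₀ β₀' : Fin (d + 1)} {c c' : ℝ}
    (hg : ∀ (x : Fin (d + 1) → ℤ) (β : Fin (d + 1)), g x (Sum.inl β) = if x = u ∧ β = β₀ then c else 0)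
    (hg' : ∀ (x : Fin (d + 1) → ℤ) (β : Fin (d + 1)), g' x (Sum.inl β) = if x = u' ∧ β = β₀' then c' else 0)
    (hVrow : ∀ (x : Fin (d + 1) → ℤ) (a b : Fin (d + 1)), Summable fun z => V x z (Sum.inl a) (Sum.inl b))
    (hVcol : ∀ (z : Fin (d + 1) → ℤ) (a b : Fin (d + 1)), Summable fun x => V x z (Sum.inl a) (Sum.inl b))
    (hV'row : ∀ (x : Fin (d + 1) → ℤ) (a b : Fin (d + 1)), Summable fun z => V' x z (Sum.inl a) (Sum.inl b))
    (hV'col : ∀ (z : Fin (d + 1) → ℤ) (a b : Fin (d + 1)), Summable fun x => V' x z (Sum.inl a) (Sum.inl b))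
    (κ₁ κ₂ : Fin (d + 1)) :
    (∑' x, ∑' z, conjW₁ V V' (diagK g) (diagK g') x z (Sum.inl κ₁) (Sum.inl κ₂))
      = c * ((if κ₂ = β₀ then ∑' x, V' x u (Sum.inl κ₁) (Sum.inl κ₂) else 0) - (if κ₁ = β₀ then ∑' z, V' u z (Sum.inl κ₁) (Sum.inl κ₂) else 0))
        + c' * ((if κ₂ = β₀' then ∑' x, V x u' (Sum.inl κ₁) (Sum.inl κ₂) else 0) - (if κ₁ = β₀' then ∑' z, V u' z (Sum.inl κ₁) (Sum.inl κ₂) else 0)) := by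
  classical
  -- entrywise: V′·(g z − g x) + V·(g′ z − g′ x), each `g` a delta
  have hsplit : ∀ x z, conjW₁ V V' (diagK g) (diagK g') x z (Sum.inl κ₁) (Sum.inl κ₂)
      = ((if z = u then V' x z (Sum.inl κ₁) (Sum.inl κ₂) * (if κ₂ = β₀ then c else 0) else 0)
          - (if x = u then V' x z (Sum.inl κ₁) (Sum.inl κ₂) * (if κ₁ = β₀ then c else 0) else 0))
        + ((if z = u' then V x z (Sum.inl κ₁) (Sum.inl κ₂) * (if κ₂ = β₀' then c' else 0) else 0)
          - (if x = u' then V x z (Sum.inl κ₁) (Sum.inl κ₂) * (if κ₁ = β₀' then c' else 0) else 0)) := by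
    intro x z
    have e1 : V' x z (Sum.inl κ₁) (Sum.inl κ₂) * g z (Sum.inl κ₂) = if z = u then V' x z (Sum.inl κ₁) (Sum.inl κ₂) * (if κ₂ = β₀ then c else 0) else 0 := by
      rw [hg]; by_cases h1 : z = u <;> by_cases h2 : κ₂ = β₀ <;> simp [h1, h2]
    have e2 : V' x z (Sum.inl κ₁) (Sum.inl κ₂) * g x (Sum.inl κ₁) = if x = u then V' x z (Sum.inl κ₁) (Sum.inl κ₂) * (if κ₁ = β₀ then c else 0) else 0 := by
      rw [hg]; by_cases h1 : x = u <;> by_cases h2 : κ₁ = β₀ <;> simp [h1, h2]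
    have e3 : V x z (Sum.inl κ₁) (Sum.inl κ₂) * g' z (Sum.inl κ₂) = if z = u' then V x z (Sum.inl κ₁) (Sum.inl κ₂) * (if κ₂ = β₀' then c' else 0) else 0 := by
      rw [hg']; by_cases h1 : z = u' <;> by_cases h2 : κ₂ = β₀' <;> simp [h1, h2]
    have e4 : V x z (Sum.inl κ₁) (Sum.inl κ₂) * g' x (Sum.inl κ₁) = if x = u' then V x z (Sum.inl κ₁) (Sum.inl κ₂) * (if κ₁ = β₀' then c' else 0) else 0 := by
      rw [hg']; by_cases h1 : x = u' <;> by_cases h2 : κ₁ = β₀' <;> simp [h1, h2]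
    rw [conjW₁_diag_apply, mul_sub, mul_sub, e1, e2, e3, e4]
  -- inner sums (in `z` at fixed `x`)
  have sA : ∀ x, Summable fun z => (if z = u then V' x z (Sum.inl κ₁) (Sum.inl κ₂) * (if κ₂ = β₀ then c else 0) else 0) := fun x =>
    summable_of_ne_finset_zero (s := {u}) fun z hz => by rw [Finset.mem_singleton] at hz; rw [if_neg hz]
  have sB : ∀ x, Summable fun z => (if x = u then V' x z (Sum.inl κ₁) (Sum.inl κ₂) * (if κ₁ = β₀ then c else 0) else 0) := fun x => by
    by_cases hx : x = u
    · simp only [hx, if_true]; exact (hV'row u κ₁ κ₂).mul_right _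
    · simp only [hx, if_false]; exact summable_zero
  have sC : ∀ x, Summable fun z => (if z = u' then V x z (Sum.inl κ₁) (Sum.inl κ₂) * (if κ₂ = β₀' then c' else 0) else 0) := fun x =>
    summable_of_ne_finset_zero (s := {u'}) fun z hz => by rw [Finset.mem_singleton] at hz; rw [if_neg hz]
  have sD : ∀ x, Summable fun z => (if x = u' then V x z (Sum.inl κ₁) (Sum.inl κ₂) * (if κ₁ = β₀' then c' else 0) else 0) := fun x => by
    by_cases hx : x = u'
    · simp only [hx, if_true]; exact (hVrow u' κ₁ κ₂).mul_right _
    · simp only [hx, if_false]; exact summable_zero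
  have iA : ∀ x, ∑' z, (if z = u then V' x z (Sum.inl κ₁) (Sum.inl κ₂) * (if κ₂ = β₀ then c else 0) else 0) = V' x u (Sum.inl κ₁) (Sum.inl κ₂) * (if κ₂ = β₀ then c else 0) := fun x =>
    tsum_point' u fun z => V' x z (Sum.inl κ₁) (Sum.inl κ₂) * (if κ₂ = β₀ then c else 0)
  have iB : ∀ x, ∑' z, (if x = u then V' x z (Sum.inl κ₁) (Sum.inl κ₂) * (if κ₁ = β₀ then c else 0) else 0) = if x = u then (∑' z, V' x z (Sum.inl κ₁) (Sum.inl κ₂)) * (if κ₁ = β₀ then c else 0) else 0 := fun x => by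
    by_cases hx : x = u
    · simp only [hx, if_true]; exact tsum_mul_right
    · simp only [hx, if_false, tsum_zero]
  have iC : ∀ x, ∑' z, (if z = u' then V x z (Sum.inl κ₁) (Sum.inl κ₂) * (if κ₂ = β₀' then c' else 0) else 0) = V x u' (Sum.inl κ₁) (Sum.inl κ₂) * (if κ₂ = β₀' then c' else 0) := fun x =>
    tsum_point' u' fun z => V x z (Sum.inl κ₁) (Sum.inl κ₂) * (if κ₂ = β₀' then c' else 0)
  have iD : ∀ x, ∑' z, (if x = u' then V x z (Sum.inl κ₁) (Sum.inl κ₂) * (if κ₁ = β₀' then c' else 0) else 0) = if x = u' then (∑' z, V x z (Sum.inl κ₁) (Sum.inl κ₂)) * (if κ₁ = β₀' then c' else 0) else 0 := fun x => by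
    by_cases hx : x = u'
    · simp only [hx, if_true]; exact tsum_mul_right
    · simp only [hx, if_false, tsum_zero]
  have inner : ∀ x, ∑' z, conjW₁ V V' (diagK g) (diagK g') x z (Sum.inl κ₁) (Sum.inl κ₂)
      = (V' x u (Sum.inl κ₁) (Sum.inl κ₂) * (if κ₂ = β₀ then c else 0) - (if x = u then (∑' z, V' x z (Sum.inl κ₁) (Sum.inl κ₂)) * (if κ₁ = β₀ then c else 0) else 0))
        + (V x u' (Sum.inl κ₁) (Sum.inl κ₂) * (if κ₂ = β₀' then c' else 0) - (if x = u' then (∑' z, V x z (Sum.inl κ₁) (Sum.inl κ₂)) * (if κ₁ = β₀' then c' else 0) else 0)) := by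
    intro x
    simp_rw [hsplit]
    rw [((sA x).sub (sB x)).tsum_add ((sC x).sub (sD x)), (sA x).tsum_sub (sB x), (sC x).tsum_sub (sD x), iA, iB, iC, iD]
  simp_rw [inner]
  -- outer sums (in `x`)
  have oA : Summable fun x => V' x u (Sum.inl κ₁) (Sum.inl κ₂) * (if κ₂ = β₀ then c else 0) := (hV'col u κ₁ κ₂).mul_right _
  have oB : Summable fun x => (if x = u then (∑' z, V' x z (Sum.inl κ₁) (Sum.inl κ₂)) * (if κ₁ = β₀ then c else 0) else 0) :=
    summable_of_ne_finset_zero (s := {u}) fun x hx => by rw [Finset.mem_singleton] at hx; rw [if_neg hx]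
  have oC : Summable fun x => V x u' (Sum.inl κ₁) (Sum.inl κ₂) * (if κ₂ = β₀' then c' else 0) := (hVcol u' κ₁ κ₂).mul_right _
  have oD : Summable fun x => (if x = u' then (∑' z, V x z (Sum.inl κ₁) (Sum.inl κ₂)) * (if κ₁ = β₀' then c' else 0) else 0) :=
    summable_of_ne_finset_zero (s := {u'}) fun x hx => by rw [Finset.mem_singleton] at hx; rw [if_neg hx]
  have vB : ∑' x, (if x = u then (∑' z, V' x z (Sum.inl κ₁) (Sum.inl κ₂)) * (if κ₁ = β₀ then c else 0) else 0) = (∑' z, V' u z (Sum.inl κ₁) (Sum.inl κ₂)) * (if κ₁ = β₀ then c else 0) :=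
    tsum_point' u fun x => (∑' z, V' x z (Sum.inl κ₁) (Sum.inl κ₂)) * (if κ₁ = β₀ then c else 0)
  have vD : ∑' x, (if x = u' then (∑' z, V x z (Sum.inl κ₁) (Sum.inl κ₂)) * (if κ₁ = β₀' then c' else 0) else 0) = (∑' z, V u' z (Sum.inl κ₁) (Sum.inl κ₂)) * (if κ₁ = β₀' then c' else 0) :=
    tsum_point' u' fun x => (∑' z, V x z (Sum.inl κ₁) (Sum.inl κ₂)) * (if κ₁ = β₀' then c' else 0)
  rw [(oA.sub oB).tsum_add (oC.sub oD), oA.tsum_sub oB, oC.tsum_sub oD, tsum_mul_right, tsum_mul_right, vB, vD]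
  split_ifs <;> ring


/-! ## Re-centring the cubic cell charge: the cell may sit on the second kernel leg instead of the bond slot -/

/-- NOT IN PRINT; OUR BOOKKEEPING.  **RE-CENTRING** (leaf-04 g65's `CovariantFamilyCellPairing.sum_box_tsum_mul_periodic` at `A := 1` + Fubini): for an `N`-block-covariant vertex
family `S κ′` (`S κ′ (u + N•t) = shiftK (−N•t) (S κ′ u)`), summable in the bond slot at every pinned leg and jointly summable in its two kernel legs,
`Σ_{r∈box} Σ'_u Σ'_x S κ′ u x (toSite r) (inl κ₁)(inl κ₂) = Σ_{r∈box} Σ'_x Σ'_z S κ′ (toSite r) x z (inl κ₁)(inl κ₂)` — the one-leg-pinned sums of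
`tsum_tsum_conjW₁_diagK_eq`, summed over the literal's bond slots, ARE the cubic cell charges of `ZeroModeReflectionParity` §4–§5. -/
theorem sum_box_tsum_tsum_recentre {N : ℕ} [NeZero N] {S : Fin (d + 1) → (Fin (d + 1) → ℤ) → MKer (d + 1) (Fib d)} (κ' κ₁ κ₂ : Fin (d + 1))
    (hS : ∀ (u t : Fin (d + 1) → ℤ), S κ' (u + (N : ℤ) • t) = shiftK (-((N : ℤ) • t)) (S κ' u))
    (hU : ∀ (z : Fin (d + 1) → ℤ), Summable fun u => ∑' x, S κ' u x z (Sum.inl κ₁) (Sum.inl κ₂))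
    (hP : ∀ (u : Fin (d + 1) → ℤ), Summable (Function.uncurry fun x z => S κ' u x z (Sum.inl κ₁) (Sum.inl κ₂))) :
    ∑ r ∈ box (d + 1) N, ∑' u, ∑' x, S κ' u x (toSite r) (Sum.inl κ₁) (Sum.inl κ₂)
      = ∑ r ∈ box (d + 1) N, ∑' x, ∑' z, S κ' (toSite r) x z (Sum.inl κ₁) (Sum.inl κ₂) := by
  -- the family `j u z := Σ'_x S κ′ u x z` is jointly covariant in `(u, z)`
  have hcov : ∀ u z t : Fin (d + 1) → ℤ, (∑' x, S κ' (u + (N : ℤ) • t) x (z + (N : ℤ) • t) (Sum.inl κ₁) (Sum.inl κ₂))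
      = ∑' x, S κ' u x z (Sum.inl κ₁) (Sum.inl κ₂) := by
    intro u z t
    rw [hS, ← (Equiv.addRight ((N : ℤ) • t)).tsum_eq (fun x => shiftK (-((N : ℤ) • t)) (S κ' u) x (z + (N : ℤ) • t) (Sum.inl κ₁) (Sum.inl κ₂))]
    refine tsum_congr fun x => ?_
    simp only [shiftK, Equiv.coe_addRight, add_neg_cancel_right]
  -- summability of `z ↦ j u z` from the joint summability of the two kernel legs
  have hZ : ∀ u, Summable fun z => (∑' x, S κ' u x z (Sum.inl κ₁) (Sum.inl κ₂)) * (1 : ℝ) := fun u => by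
    simp only [mul_one]; exact (hP u).prod_symm.prod
  have h := sum_box_tsum_mul_periodic (N := N) (j := fun u z => ∑' x, S κ' u x z (Sum.inl κ₁) (Sum.inl κ₂)) (A := fun _ => (1 : ℝ))
    hcov (fun _ _ => rfl) hU hZ
  simp only [mul_one] at h
  rw [← h]
  refine Finset.sum_congr rfl fun r _ => ?_
  exact (hP (toSite r)).tsum_comm

end Summit.QuantumFields.BalabanUV.Beta.GAN24.ZeroModeReflectionParityWords

end
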